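import Summits.BirchSwinnertonDyer.BirchSwinnertonDyer.Theorems.Rank1ResidualJetCarrierEndFormsSwapNoCV
import Summits.BirchSwinnertonDyer.BirchSwinnertonDyer.Theorems.Rank1ResidualJetCarrierEndFormsLiteratureNoCV
import HarnessLib

/-!
# T1 JET (cell `bsd-jet`), road K — striking McCallum 1991 Prop. 5.2 (`h52`), brick 6c: the END FORMS
# with `h52` REPLACED by `hR`: K3 ∕ K1 ∕ K4 ⟸ `hR` + {Poitou–Tate, F1 = [GZ86 III (3.1)], (γ) = Gross
# Prop. 3.7 (2)} — McCallum Prop. 5.2 no longer an input of road K once `hR` is fed by brick 4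

HONEST FRAMING (programme file §HONESTY, verbatim): «no tranche here proves BSD; ARM L moves the
LITERAL column of an r ≤ 1 census into the kernel-proved-modulo-named-print column.» THEOREMS ONLY
(seat `bsd-jet-pv-2`, session g6; `--supports stmt-BirchSwinnertonDyer-14418`, helper); 0 classes move;
road-K DOCUMENTARY; K1 ∕ K3 ∕ K4 stay `@[conjecture]`, conditional on `hR`, `hPT`, `hF1`, `h372`.

WHAT. pv-1 g8's `jetchevDivisibilityCarrier{Mult,Ne,Add}_of_literatureNoCV` VERBATIM with `h52 ↦ hR`
over brick 6b (`…_of_levelRaisingNoCV`): `h44 := JET.prop44_of_frobeniusCongruence h372`,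
`hGZ := JET.forall_hGZ_of_Gross1991 hF1`. `hR` = «level raising at minimal depth» = the conclusion of
brick 4 `Swap.exists_conductor_levelIndex_ge_of_minDepth` (Kolyvagin's prime-swap walk, kernel) —
its remaining inputs are the level-`p` structure suppliers (inv ⟸ `hPT`; Weil datum; the global
intrinsic transverse family with `hloc`, `hdisj`, `h𝒯σ`, `h𝒯sd` — all tree theorems at level `p^k`) and
the plumbing binder `hcompat` (compatible-data triple). ROAD-K NAMED PRINT after `hR` is fed:
{Poitou–Tate, F1, Gross 3.7 (2)} — McCallum 5.2 STRUCK at its point of use.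
References (locators only): [cite: Jetchev2008, Thm. 1.4, Thm. 5.2, Prop. 4.9, Prop. 5.3]
[cite: McCallumLMS1991, Prop. 4.4, Prop. 5.2] [cite: GrossLMS1991, Prop. 3.7, §6] [cite: GrossZagier1986,
III (3.1)]. Design: no definitions; `K : Type`. Axioms: `propext`, `Classical.choice`, `Quot.sound`.
-/

set_option autoImplicit false

noncomputable section

open scoped Classical

open WeierstrassCurve IsDedekindDomain NumberField Field Literature.NumberTheory.EllipticCurves
  Literature.NumberTheory.EllipticCurves.ModularForms Literature.NumberTheory.EllipticCurves.Jetchev2008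
  Literature.NumberTheory.EllipticCurves.KolyvaginCocycle
  Literature.NumberTheory.GaloisRepresentations Literature.NumberTheory.GaloisCohomology
  Literature.NumberTheory.GaloisRepresentations.DiscreteGaloisModule
  Summit.BirchSwinnertonDyer.Rank1Residual.X11b Summit.BirchSwinnertonDyer.Rank1Residual.X11b.Three
  Summit.BirchSwinnertonDyer.Rank1Residual.JET.SelmerVocabulary Literature.NumberTheory.Automorphic
  Summit.BirchSwinnertonDyer.BirchSwinnertonDyer.Theorems

namespace Summit.BirchSwinnertonDyer.Rank1Residual.JET

/-- **K3 ⟸ `hR` (level raising, kernel walk) + THREE named Literature statements, NO reading binder** (multiplicative carrier `p ∣ N`):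
{Poitou–Tate for Selmer structures, F1, (γ) Gross Prop. 3.7 (2) image-free}.
[cite: Jetchev2008, Thm. 1.4, Thm. 5.2, Prop. 4.9, Prop. 5.3] [cite: McCallumLMS1991, Prop. 4.4, Prop. 5.2]
[cite: GrossLMS1991, Prop. 3.7, §6] [cite: GrossZagier1986, III (3.1)] -/
theorem jetchevDivisibilityCarrierMult_of_levelRaisingLiterature
    (hR : ∀ (W : WeierstrassCurve ℚ) [W.IsElliptic] [W.IsGloballyMinimal] [NeZero (W.conductorNorm ℤ)],
      ¬ W.HasCM → ∀ (K : Type) [Field K] [NumberField K], IsImaginaryQuadratic K →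
      NumberField.discr K ≠ -3 → NumberField.discr K ≠ -4 →
      SatisfiesHeegnerHypothesis (W.conductorNorm ℤ) K →
      ∀ (p : ℕ) [Fact p.Prime], p ≠ 2 → (∀ n : ℕ, W.HasSurjectiveModNGaloisRep (p ^ n : ℕ)) →
      ∀ (Dt : ModularParametrizationData W (W.conductorNorm ℤ)) (β : ℤ) (ι : K →+* ℂ) (u : ℕ),
      (∀ (c : ℕ), Squarefree c →
        (∀ q ∈ c.primeFactors, Zhang2014.IsKolyvaginPrime (W.conductorNorm ℤ) W K p q ∧
          1 + u ≤ Zhang2014.kolyvaginIndex W p q) →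
        ∀ dc : KolyvaginHeegnerData Dt β ι c,
        ∃ Q : (W.baseChange (ringClassField K ι c)).toAffine.Point,
          ((p ^ u : ℕ) : ℤ) • Q = dc.derivedPoint) →
      ∀ (n₀ : ℕ), Squarefree n₀ →
        (∀ q ∈ n₀.primeFactors, Zhang2014.IsKolyvaginPrime (W.conductorNorm ℤ) W K p q ∧
          1 + u ≤ Zhang2014.kolyvaginIndex W p q) →
        ∀ d₀ : KolyvaginHeegnerData Dt β ι n₀,
        (¬ ∃ Q : (W.baseChange (ringClassField K ι n₀)).toAffine.Point,
          ((p ^ (u + 1) : ℕ) : ℤ) • Q = d₀.derivedPoint) →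
        ∀ m' : ℕ, ∃ (n : ℕ) (d : KolyvaginHeegnerData Dt β ι n), Squarefree n ∧
          (∀ q ∈ n.primeFactors, Zhang2014.IsKolyvaginPrime (W.conductorNorm ℤ) W K p q ∧
            max m' (1 + u) ≤ Zhang2014.kolyvaginIndex W p q) ∧
          ¬ ∃ Q : (W.baseChange (ringClassField K ι n)).toAffine.Point,
            ((p ^ (u + 1) : ℕ) : ℤ) • Q = d.derivedPoint)
    (hPT : ∀ (K : Type) [Field K] [NumberField K], poitouTate_selmerStructure_duality_conj K)
    (hF1 : Gross1991_heegnerPoint_sub_ratTorsion_mem_E0)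
    (h372 : GrossLMS1991.prop37_2_frobeniusCongruence) :
    JetchevDivisibilityCarrierMult :=
  jetchevDivisibilityCarrierMult_of_levelRaisingNoCV hR (prop44_of_frobeniusCongruence h372) hPT
    (forall_hGZ_of_Gross1991 hF1)

/-- **K1 ⟸ `hR` (level raising, kernel walk) + THREE named Literature statements, NO reading binder** (carrier a prime `q ∣ N`, `q ≠ p`).
[cite: Jetchev2008, Thm. 1.4, Thm. 5.2, Prop. 4.9, Prop. 5.3] [cite: McCallumLMS1991, Prop. 4.4, Prop. 5.2]
[cite: GrossLMS1991, Prop. 3.7, §6] [cite: GrossZagier1986, III (3.1)] -/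
theorem jetchevDivisibilityCarrierNe_of_levelRaisingLiterature
    (hR : ∀ (W : WeierstrassCurve ℚ) [W.IsElliptic] [W.IsGloballyMinimal] [NeZero (W.conductorNorm ℤ)],
      ¬ W.HasCM → ∀ (K : Type) [Field K] [NumberField K], IsImaginaryQuadratic K →
      NumberField.discr K ≠ -3 → NumberField.discr K ≠ -4 →
      SatisfiesHeegnerHypothesis (W.conductorNorm ℤ) K →
      ∀ (p : ℕ) [Fact p.Prime], p ≠ 2 → (∀ n : ℕ, W.HasSurjectiveModNGaloisRep (p ^ n : ℕ)) →
      ∀ (Dt : ModularParametrizationData W (W.conductorNorm ℤ)) (β : ℤ) (ι : K →+* ℂ) (u : ℕ),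
      (∀ (c : ℕ), Squarefree c →
        (∀ q ∈ c.primeFactors, Zhang2014.IsKolyvaginPrime (W.conductorNorm ℤ) W K p q ∧
          1 + u ≤ Zhang2014.kolyvaginIndex W p q) →
        ∀ dc : KolyvaginHeegnerData Dt β ι c,
        ∃ Q : (W.baseChange (ringClassField K ι c)).toAffine.Point,
          ((p ^ u : ℕ) : ℤ) • Q = dc.derivedPoint) →
      ∀ (n₀ : ℕ), Squarefree n₀ →
        (∀ q ∈ n₀.primeFactors, Zhang2014.IsKolyvaginPrime (W.conductorNorm ℤ) W K p q ∧
          1 + u ≤ Zhang2014.kolyvaginIndex W p q) →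
        ∀ d₀ : KolyvaginHeegnerData Dt β ι n₀,
        (¬ ∃ Q : (W.baseChange (ringClassField K ι n₀)).toAffine.Point,
          ((p ^ (u + 1) : ℕ) : ℤ) • Q = d₀.derivedPoint) →
        ∀ m' : ℕ, ∃ (n : ℕ) (d : KolyvaginHeegnerData Dt β ι n), Squarefree n ∧
          (∀ q ∈ n.primeFactors, Zhang2014.IsKolyvaginPrime (W.conductorNorm ℤ) W K p q ∧
            max m' (1 + u) ≤ Zhang2014.kolyvaginIndex W p q) ∧
          ¬ ∃ Q : (W.baseChange (ringClassField K ι n)).toAffine.Point,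
            ((p ^ (u + 1) : ℕ) : ℤ) • Q = d.derivedPoint)
    (hPT : ∀ (K : Type) [Field K] [NumberField K], poitouTate_selmerStructure_duality_conj K)
    (hF1 : Gross1991_heegnerPoint_sub_ratTorsion_mem_E0)
    (h372 : GrossLMS1991.prop37_2_frobeniusCongruence) :
    JetchevDivisibilityCarrierNe :=
  jetchevDivisibilityCarrierNe_of_levelRaisingNoCV hR (prop44_of_frobeniusCongruence h372) hPT
    (forall_hGZ_of_Gross1991 hF1)

/-- **K4 ⟸ `hR` (level raising, kernel walk) + THREE named Literature statements, NO reading binder** (carrier `p`, `E` additive at `p`).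
[cite: Jetchev2008, Thm. 1.4, Thm. 5.2, Prop. 4.9, Prop. 5.3] [cite: McCallumLMS1991, Prop. 4.4, Prop. 5.2]
[cite: GrossLMS1991, Prop. 3.7, §6] [cite: GrossZagier1986, III (3.1)] -/
theorem jetchevDivisibilityCarrierAdd_of_levelRaisingLiterature
    (hR : ∀ (W : WeierstrassCurve ℚ) [W.IsElliptic] [W.IsGloballyMinimal] [NeZero (W.conductorNorm ℤ)],
      ¬ W.HasCM → ∀ (K : Type) [Field K] [NumberField K], IsImaginaryQuadratic K →
      NumberField.discr K ≠ -3 → NumberField.discr K ≠ -4 →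
      SatisfiesHeegnerHypothesis (W.conductorNorm ℤ) K →
      ∀ (p : ℕ) [Fact p.Prime], p ≠ 2 → (∀ n : ℕ, W.HasSurjectiveModNGaloisRep (p ^ n : ℕ)) →
      ∀ (Dt : ModularParametrizationData W (W.conductorNorm ℤ)) (β : ℤ) (ι : K →+* ℂ) (u : ℕ),
      (∀ (c : ℕ), Squarefree c →
        (∀ q ∈ c.primeFactors, Zhang2014.IsKolyvaginPrime (W.conductorNorm ℤ) W K p q ∧
          1 + u ≤ Zhang2014.kolyvaginIndex W p q) →
        ∀ dc : KolyvaginHeegnerData Dt β ι c,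
        ∃ Q : (W.baseChange (ringClassField K ι c)).toAffine.Point,
          ((p ^ u : ℕ) : ℤ) • Q = dc.derivedPoint) →
      ∀ (n₀ : ℕ), Squarefree n₀ →
        (∀ q ∈ n₀.primeFactors, Zhang2014.IsKolyvaginPrime (W.conductorNorm ℤ) W K p q ∧
          1 + u ≤ Zhang2014.kolyvaginIndex W p q) →
        ∀ d₀ : KolyvaginHeegnerData Dt β ι n₀,
        (¬ ∃ Q : (W.baseChange (ringClassField K ι n₀)).toAffine.Point,
          ((p ^ (u + 1) : ℕ) : ℤ) • Q = d₀.derivedPoint) →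
        ∀ m' : ℕ, ∃ (n : ℕ) (d : KolyvaginHeegnerData Dt β ι n), Squarefree n ∧
          (∀ q ∈ n.primeFactors, Zhang2014.IsKolyvaginPrime (W.conductorNorm ℤ) W K p q ∧
            max m' (1 + u) ≤ Zhang2014.kolyvaginIndex W p q) ∧
          ¬ ∃ Q : (W.baseChange (ringClassField K ι n)).toAffine.Point,
            ((p ^ (u + 1) : ℕ) : ℤ) • Q = d.derivedPoint)
    (hPT : ∀ (K : Type) [Field K] [NumberField K], poitouTate_selmerStructure_duality_conj K)
    (hF1 : Gross1991_heegnerPoint_sub_ratTorsion_mem_E0)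
    (h372 : GrossLMS1991.prop37_2_frobeniusCongruence) :
    JetchevDivisibilityCarrierAdd :=
  jetchevDivisibilityCarrierAdd_of_levelRaisingNoCV hR (prop44_of_frobeniusCongruence h372) hPT
    (forall_hGZ_of_Gross1991 hF1)

end Summit.BirchSwinnertonDyer.Rank1Residual.JET

end
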